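import Summits.CriticalPhenomena.PercolationContinuityZ3.Theorems.PercNearOneGluingNoHeavyLowerTailSahiGridPatternOrthantHarris
import Summits.CriticalPhenomena.PercolationContinuityZ3.Theorems.PercNearOneGluingNoHeavyLowerTailSahiGridPatternTwoSetsTop

/-!
# `NoHeavyLowerTail` (crux stmt-CriticalPhenomena-4575), Sahi programme P1: **THE HARRIS-REDUCED PATTERN FUNCTIONAL IS A SUM OF PRODUCTS OF
# TWO INCREMENTS OVER THE BOOLEAN CHART** — `G({u};B,C) = Σ_T (1_B(u^T) − 1_B(u))·(1_C(u^{Tᶜ}) − 1_C(u))`, every point `u`, every dimension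

Support file (Sahi cell, seat `prim-sahi-p1`, generation 18; `--supports stmt-CriticalPhenomena-4575`).  Pure proofs, NO definitions, no `sorry`,
standard axioms.  Vocabulary of `…SahiGridPattern{,SliceForm,ZDecomp,TwoLayerTop,TwoSetsTop,OrthantHarris}` (`fromSet u T` = the chart of the
Boolean cube of points totally distinct from `u`: value `hiVal (u a)` on `T`, `loVal (u a)` off `T`; `TotDist`, `thirdPt`, `ind`, `sStarD_counting`).

THE MATHEMATICS.  Write `G(U;B,C) := sStarD U B C − H(U,B∩C) = sStarD U B C + N(U;B∩C) − 2^n·#(U∩B∩C)` for the Harris-reduced pattern functional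
of generation 18 (`…OrthantHarris`: `G(↑p;B,C) ≥ 0`; `…MeetFaceHarris`: `G(A;B,C) ≥ 0` on the meet face).  `G` is linear in `U`, and for a single
point the counting form collapses, via the chart `T ↦ u^T := fromSet u T` (whose image is exactly the set of points totally distinct from `u`, with
`(u, u^T, u^{Tᶜ})` exactly the Latin triples through `u`, `thirdPt_fromSet`), to a SIGNED SUM OF PRODUCTS OF TWO INCREMENTS:
  **`sStarD {u} B C + Σ_y 1_B(y)1_C(y)[y δ̸ u] − 2^n·1_B(u)1_C(u) = Σ_{T ⊆ [n]} (1_B(u^T) − 1_B(u))·(1_C(u^{Tᶜ}) − 1_C(u))`**  (`harrisReduced_single`),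
for EVERY `u ∈ [3]^n` and ALL finsets `B, C` (no monotonicity needed); summing over `u ∈ U` gives `G(U;B,C)` (`harrisReduced_eq_sum`).  For up-sets,
`T ↦ 1_B(u^T)` is increasing and `T ↦ 1_C(u^{Tᶜ})` decreasing (`fromSet_mono`); the summand at `u` is `≥ 0` termwise when `u ∈ B∩C` or
`u ∉ B∪C` and `≤ 0` termwise on `B △ C` (`harrisReduced_single_nonneg_of_mem_inter`, `…_of_not_mem_union`).  So `G(U;B,C) ≥ 0` is the statement
that inside `U` the surplus on `B∩C` and off `B∪C` pays the deficit on `B△C`; generation 18's census (memo §0 I-c) found this true for all orthants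
(THEOREM), on the meet face (THEOREM), for all 'top-cube' up-sets `{x ≥ 1^k : twos(x) ∈ 𝒰}` with `k ≤ 4` (CONJECTURE B), and false for general `U`.
Nothing here asserts `PatternPos d` for `d ≥ 4`. [this work]
-/

namespace Summit.CriticalPhenomena.PercolationContinuityZ3.Theorems.SahiGridPattern

open Finset SahiGrid3
open scoped BigOperators

variable {n : ℕ}

/-! ### Small facts about the chart and the third point -/

/-- `q δ̸ thirdPt q u ⟺ q δ̸ u`. [this work] -/
theorem totDist_thirdPt_iff (q u : Pd n) : TotDist q (thirdPt q u) = true ↔ TotDist q u = true := by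
  rw [totDist_iff, totDist_iff]
  have key : ∀ x y : Fin 3, (x ≠ -(x + y)) ↔ (x ≠ y) := by decide
  exact ⟨fun h a => (key (q a) (u a)).1 (h a), fun h a => (key (q a) (u a)).2 (h a)⟩

/-- For `q δ̸ r`: `thirdPt q r = u ⟺ r = thirdPt q u`. [this work] -/
theorem thirdPt_eq_iff (q r u : Pd n) : thirdPt q r = u ↔ r = thirdPt q u := by
  constructor
  · intro h; rw [← h, thirdPt_thirdPt]
  · intro h; rw [h, thirdPt_thirdPt]

/-- The number of Boolean charts is `2^n`. [this work] -/
theorem card_finset_fin_pow : (Fintype.card (Finset (Fin n)) : ℤ) = 2 ^ n := by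
  rw [Fintype.card_finset, Fintype.card_fin]; push_cast; ring

/-! ### The three counting terms through the chart -/

/-- `Σ_p 1_X(p)[p δ̸ u] = Σ_T 1_X(u^T)`. [this work] -/
theorem sum_ind_totDist_eq_sum_chart (X : Finset (Pd n)) (u : Pd n) :
    (∑ p, ind X p * (if TotDist p u = true then (1:ℤ) else 0)) = ∑ T : Finset (Fin n), ind X (fromSet u T) := by
  rw [← sum_totDist_eq_sum_sets u (fun p => ind X p), Finset.sum_filter]
  exact Finset.sum_congr rfl fun p _ => by split_ifs <;> simp

/-- The complement reindexing: `Σ_T 1_X(u^{Tᶜ}) = Σ_T 1_X(u^T)`. [this work] -/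
theorem sum_chart_compl (X : Finset (Pd n)) (u : Pd n) :
    (∑ T : Finset (Fin n), ind X (fromSet u Tᶜ)) = ∑ T : Finset (Fin n), ind X (fromSet u T) :=
  Fintype.sum_bijective (fun T : Finset (Fin n) => Tᶜ) compl_involutive.bijective _ _ fun _ => rfl

/-- The Latin count through `u`: `Σ_{q,r} 1_B(q)1_C(r)[thirdPt q r = u][q δ̸ r] = Σ_T 1_B(u^T)·1_C(u^{Tᶜ})`. [this work] -/
theorem sum_latin_through_eq_sum_chart (B C : Finset (Pd n)) (u : Pd n) :
    (∑ q, ∑ r, ind B q * ind C r * (if thirdPt q r = u then (1:ℤ) else 0) * (if TotDist q r = true then (1:ℤ) else 0)) =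
      ∑ T : Finset (Fin n), ind B (fromSet u T) * ind C (fromSet u Tᶜ) := by
  -- inner sum: the only `r` is `thirdPt q u`, and it is totally distinct from `q` iff `q δ̸ u`
  have inner : ∀ q, (∑ r, ind B q * ind C r * (if thirdPt q r = u then (1:ℤ) else 0) * (if TotDist q r = true then (1:ℤ) else 0)) =
      ind B q * ind C (thirdPt q u) * (if TotDist q u = true then (1:ℤ) else 0) := by
    intro q
    rw [Finset.sum_eq_single (thirdPt q u)]
    · rw [if_pos (thirdPt_thirdPt q u)]
      by_cases h : TotDist q u = true
      · rw [if_pos h, if_pos ((totDist_thirdPt_iff q u).2 h)]; ring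
      · rw [if_neg h, if_neg (fun h' => h ((totDist_thirdPt_iff q u).1 h'))]; ring
    · intro r _ hr
      rw [if_neg (fun h => hr ((thirdPt_eq_iff q r u).1 h))]; ring
    · intro h; exact absurd (Finset.mem_univ _) h
  rw [Finset.sum_congr rfl fun q _ => inner q]
  calc (∑ q, ind B q * ind C (thirdPt q u) * (if TotDist q u = true then (1:ℤ) else 0))
      = ∑ q ∈ univ.filter (fun q : Pd n => TotDist q u = true), ind B q * ind C (thirdPt q u) := by
        rw [Finset.sum_filter]
        exact Finset.sum_congr rfl fun q _ => by split_ifs <;> simp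
    _ = ∑ T : Finset (Fin n), ind B (fromSet u T) * ind C (thirdPt (fromSet u T) u) :=
        sum_totDist_eq_sum_sets u (fun q => ind B q * ind C (thirdPt q u))
    _ = ∑ T : Finset (Fin n), ind B (fromSet u T) * ind C (fromSet u Tᶜ) :=
        Finset.sum_congr rfl fun T _ => by rw [thirdPt_fromSet]

/-! ### The witness formula -/

/-- **THE HARRIS-REDUCED FUNCTIONAL OF A SINGLE POINT** (every `n`, every `u`, any finsets `B, C`):
`sStarD {u} B C + Σ_y 1_B(y)1_C(y)[y δ̸ u] − 2^n·1_B(u)1_C(u) = Σ_T (1_B(u^T) − 1_B(u))(1_C(u^{Tᶜ}) − 1_C(u))`. [this work] -/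
theorem harrisReduced_single (u : Pd n) (B C : Finset (Pd n)) :
    sStarD ({u} : Finset (Pd n)) B C + (∑ y, ind B y * ind C y * (if TotDist y u = true then (1:ℤ) else 0))
        - 2 ^ n * (ind B u * ind C u) =
      ∑ T : Finset (Fin n), (ind B (fromSet u T) - ind B u) * (ind C (fromSet u Tᶜ) - ind C u) := by
  rw [sStarD_counting]
  simp only [ind_single_all]
  -- collapse the singleton indicators
  have e1 : (∑ p : Pd n, (if p = u then (1:ℤ) else 0) * ind B p * ind C p) = ind B u * ind C u := by
    rw [Finset.sum_eq_single u (fun p _ hp => by rw [if_neg hp]; ring) (fun h => absurd (Finset.mem_univ _) h), if_pos rfl, one_mul]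
  have e2 : (∑ p : Pd n, ∑ q : Pd n, (if p = u then (1:ℤ) else 0) * ind B q * ind C q * (if TotDist p q = true then (1:ℤ) else 0)) =
      ∑ q, ind B q * ind C q * (if TotDist q u = true then (1:ℤ) else 0) := by
    rw [Finset.sum_eq_single u (fun p _ hp => by simp only [if_neg hp, zero_mul, Finset.sum_const_zero])
      (fun h => absurd (Finset.mem_univ _) h)]
    refine Finset.sum_congr rfl fun q _ => ?_
    rw [if_pos rfl, one_mul, totDist_symm u q]
  have e3 : (∑ p : Pd n, ∑ q : Pd n, ind B p * (if q = u then (1:ℤ) else 0) * ind C q * (if TotDist p q = true then (1:ℤ) else 0)) =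
      ind C u * ∑ T : Finset (Fin n), ind B (fromSet u T) := by
    rw [← sum_ind_totDist_eq_sum_chart, Finset.mul_sum]
    refine Finset.sum_congr rfl fun p _ => ?_
    rw [Finset.sum_eq_single u (fun q _ hq => by rw [if_neg hq]; ring) (fun h => absurd (Finset.mem_univ _) h), if_pos rfl]; ring
  have e4 : (∑ p : Pd n, ∑ q : Pd n, ind C p * (if q = u then (1:ℤ) else 0) * ind B q * (if TotDist p q = true then (1:ℤ) else 0)) =
      ind B u * ∑ T : Finset (Fin n), ind C (fromSet u Tᶜ) := by
    rw [sum_chart_compl, ← sum_ind_totDist_eq_sum_chart, Finset.mul_sum]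
    refine Finset.sum_congr rfl fun p _ => ?_
    rw [Finset.sum_eq_single u (fun q _ hq => by rw [if_neg hq]; ring) (fun h => absurd (Finset.mem_univ _) h), if_pos rfl]; ring
  have e5 : (∑ q : Pd n, ∑ r : Pd n, ind B q * ind C r * (if thirdPt q r = u then (1:ℤ) else 0) * (if TotDist q r = true then (1:ℤ) else 0)) =
      ∑ T : Finset (Fin n), ind B (fromSet u T) * ind C (fromSet u Tᶜ) := sum_latin_through_eq_sum_chart B C u
  rw [e1, e2, e3, e4, e5]
  -- expand the right-hand side
  have eR : (∑ T : Finset (Fin n), (ind B (fromSet u T) - ind B u) * (ind C (fromSet u Tᶜ) - ind C u)) =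
      (∑ T : Finset (Fin n), ind B (fromSet u T) * ind C (fromSet u Tᶜ)) - ind C u * (∑ T : Finset (Fin n), ind B (fromSet u T))
      - ind B u * (∑ T : Finset (Fin n), ind C (fromSet u Tᶜ)) + 2 ^ n * (ind B u * ind C u) := by
    have h : ∀ T : Finset (Fin n), (ind B (fromSet u T) - ind B u) * (ind C (fromSet u Tᶜ) - ind C u) =
        ind B (fromSet u T) * ind C (fromSet u Tᶜ) - ind C u * ind B (fromSet u T) - ind B u * ind C (fromSet u Tᶜ) + ind B u * ind C u :=
      fun T => by ring
    simp only [h, Finset.sum_add_distrib, Finset.sum_sub_distrib, ← Finset.mul_sum, Finset.sum_const, Finset.card_univ, nsmul_eq_mul,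
      card_finset_fin_pow]
    ring
  rw [eR]
  ring

/-- Single points: the summand has a sign.  **On `B ∩ C` the reduced functional of a point is `≥ 0`** (`= #{T : u^T ∉ B, u^{Tᶜ} ∉ C}`). [this work] -/
theorem harrisReduced_single_nonneg_of_mem_inter (u : Pd n) {B C : Finset (Pd n)} (hB : u ∈ B) (hC : u ∈ C) :
    0 ≤ sStarD ({u} : Finset (Pd n)) B C + (∑ y, ind B y * ind C y * (if TotDist y u = true then (1:ℤ) else 0))
        - 2 ^ n * (ind B u * ind C u) := by
  rw [harrisReduced_single]
  refine Finset.sum_nonneg fun T _ => ?_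
  have h1 : ind B (fromSet u T) - ind B u ≤ 0 := by
    unfold ind; rw [if_pos hB]; split_ifs <;> norm_num
  have h2 : ind C (fromSet u Tᶜ) - ind C u ≤ 0 := by
    unfold ind; rw [if_pos hC]; split_ifs <;> norm_num
  exact mul_nonneg_of_nonpos_of_nonpos h1 h2

/-- **Off `B ∪ C` the reduced functional of a point is `≥ 0`** (`= #{T : u^T ∈ B, u^{Tᶜ} ∈ C}`, the Latin triples through `u`). [this work] -/
theorem harrisReduced_single_nonneg_of_not_mem_union (u : Pd n) {B C : Finset (Pd n)} (hB : u ∉ B) (hC : u ∉ C) :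
    0 ≤ sStarD ({u} : Finset (Pd n)) B C + (∑ y, ind B y * ind C y * (if TotDist y u = true then (1:ℤ) else 0))
        - 2 ^ n * (ind B u * ind C u) := by
  rw [harrisReduced_single]
  refine Finset.sum_nonneg fun T _ => ?_
  have h1 : 0 ≤ ind B (fromSet u T) - ind B u := by
    unfold ind; rw [if_neg hB]; split_ifs <;> norm_num
  have h2 : 0 ≤ ind C (fromSet u Tᶜ) - ind C u := by
    unfold ind; rw [if_neg hC]; split_ifs <;> norm_num
  exact mul_nonneg h1 h2

/-- **On `B △ C` the reduced functional of a point is `≤ 0`** (here: `u ∈ B ∖ C`). [this work] -/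
theorem harrisReduced_single_nonpos_of_mem_sdiff (u : Pd n) {B C : Finset (Pd n)} (hB : u ∈ B) (hC : u ∉ C) :
    sStarD ({u} : Finset (Pd n)) B C + (∑ y, ind B y * ind C y * (if TotDist y u = true then (1:ℤ) else 0))
        - 2 ^ n * (ind B u * ind C u) ≤ 0 := by
  rw [harrisReduced_single]
  refine Finset.sum_nonpos fun T _ => ?_
  have h1 : ind B (fromSet u T) - ind B u ≤ 0 := by
    unfold ind; rw [if_pos hB]; split_ifs <;> norm_num
  have h2 : 0 ≤ ind C (fromSet u Tᶜ) - ind C u := by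
    unfold ind; rw [if_neg hC]; split_ifs <;> norm_num
  exact mul_nonpos_of_nonpos_of_nonneg h1 h2

/-- **THE HARRIS-REDUCED FUNCTIONAL AS A SUM OVER POINTS AND CHARTS** (every `n`, any finsets `U, B, C`):
`sStarD U B C + Σ_{x,y} 1_U(x)1_B(y)1_C(y)[x δ̸ y] − 2^n·Σ_x 1_U1_B1_C = Σ_{u∈U} Σ_T (1_B(u^T) − 1_B(u))(1_C(u^{Tᶜ}) − 1_C(u))`. [this work] -/
theorem harrisReduced_eq_sum (U B C : Finset (Pd n)) :
    sStarD U B C + (∑ x, ∑ y, ind U x * ind B y * ind C y * (if TotDist x y = true then (1:ℤ) else 0))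
        - 2 ^ n * (∑ x, ind U x * ind B x * ind C x) =
      ∑ u ∈ U, ∑ T : Finset (Fin n), (ind B (fromSet u T) - ind B u) * (ind C (fromSet u Tᶜ) - ind C u) := by
  -- linearity of the three terms in `U`
  have hS : sStarD U B C = ∑ u ∈ U, sStarD ({u} : Finset (Pd n)) B C := by
    rw [sStarD_eq_sum_tcD]
    exact Finset.sum_congr rfl fun u _ => by rw [sStarD_eq_sum_tcD, Finset.sum_singleton]
  have hN : (∑ x, ∑ y, ind U x * ind B y * ind C y * (if TotDist x y = true then (1:ℤ) else 0)) =
      ∑ u ∈ U, ∑ y, ind B y * ind C y * (if TotDist y u = true then (1:ℤ) else 0) := by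
    conv_rhs => rw [sum_mem_eq_sum_ind]
    refine Finset.sum_congr rfl fun x _ => ?_
    rw [Finset.mul_sum]
    exact Finset.sum_congr rfl fun y _ => by rw [totDist_symm x y]; ring
  have hD : (∑ x, ind U x * ind B x * ind C x) = ∑ u ∈ U, ind B u * ind C u := by
    conv_rhs => rw [sum_mem_eq_sum_ind]
    exact Finset.sum_congr rfl fun x _ => by ring
  rw [hS, hN, hD, Finset.mul_sum, ← Finset.sum_add_distrib, ← Finset.sum_sub_distrib]
  exact Finset.sum_congr rfl fun u _ => harrisReduced_single u B C

end Summit.CriticalPhenomena.PercolationContinuityZ3.Theorems.SahiGridPattern
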